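import Summits.CriticalPhenomena.PercolationContinuityZ3.Theorems.PercNearOneGluingNoHeavyLowerTailSahiGridPatternFrozenCorner
import Summits.CriticalPhenomena.PercolationContinuityZ3.Theorems.PercNearOneGluingNoHeavyLowerTailSahiGridPatternMixInjection

/-!
# `NoHeavyLowerTail` (crux stmt-CriticalPhenomena-4575), Sahi programme P1: **CONJECTURE A FOR `x ∨ y` AT THE CROSSED PAIRS WITH AN ARBITRARY SECOND
# SECTION INSIDE THE OTHER ARM** — `V = ↑a ∪ ↑b` (disjoint supports), `A₀ = ↑a'`, `B′` ANY up-set inside `B = ↑b`; every `k`, every certificate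

Support file (Sahi cell, seat `prim-sahi-p1`, generation 42; `--supports stmt-CriticalPhenomena-4575`).  Pure proofs, no definitions, no `sorry`, standard axioms.
Vocabulary of `…SahiGridPattern{,CellForm,PairCert,DiagCert,CoCountProductNCrossed,CoCountProductNCrossedAligned,FrozenCorner,MixInjection}`.

THE MATHEMATICS (seat memo FROM-prim-sahi-p1-gen42 §8).  Same outer data as `…CoCountProductNCrossedAligned` (`S = x∨y` with its certificate `c`,
`P = {x≥1}×A₀`, `Q = {q∈B′} ∪ ({y≥1}×B)`), inner block `V = ↑a ∪ ↑b` with `a` supported on `Sx` and `b` off `Sx`, `A₀ = ↑a'` (`a ≤ a'`), `B = ↑b`, and now `B′`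
is an ARBITRARY up-set with `B′ ⊆ B`.  By the crossed identity (`diagCert_coProduct_N_orTwo_crossed`) it suffices that
`3·d_V(F) ≥ 3·2^k#F + 2κ′_V(A₀,B′)` for the footprint `F = A₀ ∩ B′` (the three Harris slacks being `≥ 0`).  Two ingredients, both from generation 42:
* FROZEN CORNER (`diagCert_sum_eq_on_corner`): `F ⊆ ↑a ∩ ↑b`, so `d_V(F) = λ_V(F) = 2^k#F + Σ_{m∈F} #{s δ̸ m : s ∉ V}` for EVERY `d_V` with (T),(N);
* MIXING INJECTION (`pairThird_sum_le_mixCorner` with `φ = 1 − 1_V`): `κ′_V(A₀,B′) ≤ Σ_{m∈F} #{s δ̸ m : s ∉ V}`.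
Hence `3·d_V(F) − 3·2^k#F ≥ 3κ′ ≥ 2κ′`: **`diagCert_coProduct_N_orTwo_crossed_aligned_general`**, and with (T) for `dS` the pattern-functional corollary
**`sStarD_blockAnd_orTwo_crossed_aligned_general_nonneg`**.  At `k = 2` this covers every two-generator-`V` instance on which generation 41's word menus fail
(`V = ↑01 ∪ ↑10`, `A₀ = ↑01`, `B′ = ↑12 ∪ ↑20 ⊂ B = ↑10`, …).  Nothing here asserts Conjecture A in general or `PatternPos d` for `d ≥ 4`. [this work]
-/

namespace Summit.CriticalPhenomena.PercolationContinuityZ3.Theorems.SahiGridPattern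

open Finset SahiGrid3
open scoped BigOperators

section AlignedGeneral

variable {k : ℕ} {S Fx Gy : Finset (Pd (1 + 1))} {V : Finset (Pd k)} {A : Finset (Pd ((1 + 1) + k))}

/-- **THEOREM (Conjecture A for `x ∨ y` at the aligned crossed pairs with an arbitrary second section `B′ ⊆ ↑b`; every `k`, every certificate with (T),(N)).**
[this work] -/
theorem diagCert_coProduct_N_orTwo_crossed_aligned_general (hS : ∀ ξ η : Pd 1, glue ξ η ∈ S ↔ (1 ≤ ξ 0 ∨ 1 ≤ η 0))
    (hFx : ∀ ξ η : Pd 1, glue ξ η ∈ Fx ↔ 1 ≤ ξ 0) (hGy : ∀ ξ η : Pd 1, glue ξ η ∈ Gy ↔ 1 ≤ η 0)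
    (hA : ∀ σ z, glue σ z ∈ A ↔ (σ ∈ S ∧ z ∈ V))
    (dS : Pd (1 + 1) → ℤ) (hdS : dS (glue (fun _ => 0) (fun _ => 0)) = 0 ∧ dS (glue (fun _ => 0) (fun _ => 1)) = 4 ∧ dS (glue (fun _ => 0) (fun _ => 2)) = 4 ∧
      dS (glue (fun _ => 1) (fun _ => 0)) = 2 ∧ dS (glue (fun _ => 1) (fun _ => 1)) = 5 ∧ dS (glue (fun _ => 1) (fun _ => 2)) = 5 ∧
      dS (glue (fun _ => 2) (fun _ => 0)) = 2 ∧ dS (glue (fun _ => 2) (fun _ => 1)) = 5 ∧ dS (glue (fun _ => 2) (fun _ => 2)) = 5)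
    {a b a' : Pd k} {Sx : Finset (Fin k)} (hVm : ∀ q, q ∈ V ↔ (a ≤ q ∨ b ≤ q))
    (haS : ∀ i, i ∉ Sx → a i = 0) (hbS : ∀ i, i ∈ Sx → b i = 0) (haa : a ≤ a')
    {A0 Bp B0 : Finset (Pd k)} (hA0 : ∀ q, q ∈ A0 ↔ a' ≤ q) (hB0 : ∀ q, q ∈ B0 ↔ b ≤ q)
    (hBpu : IsUpperSet (Bp : Set (Pd k))) (hsub : Bp ⊆ B0)
    (dV : Pd k → ℤ)
    (hTV : ∀ W : Finset (Pd k), IsUpperSet (W : Set (Pd k)) → (∑ q ∈ W, dV q) ≤ ∑ q ∈ W, lamU V q)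
    (hNV : ∀ X X' : Finset (Pd k), IsUpperSet (X : Set (Pd k)) → IsUpperSet (X' : Set (Pd k)) → (∑ q ∈ X, ∑ r ∈ X', thetaVal V q r) ≤ ∑ q ∈ X ∩ X', dV q)
    {P Q : Finset (Pd ((1 + 1) + k))} (hP : ∀ σ q, glue σ q ∈ P ↔ (σ ∈ Fx ∧ q ∈ A0)) (hQ : ∀ σ q, glue σ q ∈ Q ↔ (q ∈ Bp ∨ (σ ∈ Gy ∧ q ∈ B0))) :
    (∑ x ∈ P, ∑ y ∈ Q, thetaVal A x y) ≤ ∑ x ∈ P ∩ Q, (2 * (2:ℤ) ^ ((1 + 1) + k) * (ind S (freeOf x) * ind V (cellOf x))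
        - (2 * (2:ℤ) ^ (1 + 1) * ind S (freeOf x) - dS (freeOf x)) * (2 * (2:ℤ) ^ k * ind V (cellOf x) - dV (cellOf x))) := by
  classical
  have hVu : IsUpperSet (V : Set (Pd k)) := isUpperSet_of_mem_iff_le_or hVm
  have hA0u : IsUpperSet (A0 : Set (Pd k)) := isUpperSet_of_mem_iff_le hA0
  have hB0u : IsUpperSet (B0 : Set (Pd k)) := isUpperSet_of_mem_iff_le hB0
  have hA0V : ∀ q, q ∈ A0 → q ∈ V := fun q hq => (hVm q).2 (Or.inl (le_trans haa ((hA0 q).1 hq)))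
  -- the footprint lies in the corner
  have hFcorner : ∀ q ∈ A0 ∩ Bp, a ≤ q ∧ b ≤ q := by
    intro q hq
    rw [Finset.mem_inter] at hq
    exact ⟨le_trans haa ((hA0 q).1 hq.1), (hB0 q).1 (hsub hq.2)⟩
  have hfro := diagCert_sum_eq_on_corner hVm haS hbS dV hTV hNV hFcorner
  -- names
  set tV : Pd k → Pd k → ℤ := fun q r => if TotDist q r = true then (1:ℤ) else 0 with htV
  set a1 : ℤ := ∑ q : Pd k, ∑ r : Pd k, ind A0 q * ind B0 r * tV q r * ind V q with ha1
  set a2 : ℤ := ∑ q : Pd k, ∑ r : Pd k, ind A0 q * ind B0 r * tV q r * ind V r with ha2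
  set b1 : ℤ := ∑ q : Pd k, ∑ r : Pd k, ind A0 q * ind Bp r * tV q r * ind V q with hb1
  set b2 : ℤ := ∑ q : Pd k, ∑ r : Pd k, ind A0 q * ind Bp r * tV q r * ind V r with hb2
  set mb : ℤ := ∑ q : Pd k, ∑ r : Pd k, ind A0 q * ind Bp r * tV q r * ind V (thirdPt q r) with hmb
  set nB : ℤ := ∑ q : Pd k, ind A0 q * ind B0 q * ind V q with hnB
  set nBp : ℤ := ∑ q : Pd k, ind A0 q * ind Bp q * ind V q with hnBp
  set yBp : ℤ := ∑ q : Pd k, ind A0 q * ind Bp q * dV q with hyBp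
  -- Harris / Kleitman slacks
  have hH1 : a1 ≤ 2 ^ k * nB := pairCount_le_harris hVu hA0u hB0u
  have hH2 : a2 ≤ 2 ^ k * nB := pairCount_le_harris' hVu hA0u hB0u
  have hH3 : b2 ≤ 2 ^ k * nBp := pairCount_le_harris' hVu hA0u hBpu
  have hK : mb ≤ b1 := latCount_le_pairCount hVu hA0u
  -- A0 ⊆ V: drop the factor `ind V q`
  have hindV : ∀ q, ind A0 q * ind V q = ind A0 q := by
    intro q
    unfold ind
    by_cases hq : q ∈ A0
    · rw [if_pos hq, if_pos (hA0V q hq)]; ring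
    · rw [if_neg hq]; ring
  -- the mixing injection with φ = 1 − 1_V:  b1 − mb ≤ Σ_m 1_{A0}1_{Bp}(m) Σ_s t(m,s)(1 − 1_V(s)) =: Γ
  set Γ : ℤ := ∑ m : Pd k, ∑ s : Pd k, ind A0 m * ind Bp m * tV m s * (1 - ind V s) with hΓ
  have hmix : b1 - mb ≤ Γ := by
    have h := pairThird_sum_le_mixCorner Sx hA0 hBpu (fun s => 1 - ind V s) (fun s => by unfold ind; split_ifs <;> norm_num)
    have e1 : (∑ q : Pd k, ∑ r : Pd k, ind A0 q * ind Bp r * (if TotDist q r = true then (1:ℤ) else 0) * (1 - ind V (thirdPt q r))) = b1 - mb := by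
      rw [hb1, hmb, ← Finset.sum_sub_distrib]
      refine Finset.sum_congr rfl fun q _ => ?_
      rw [← Finset.sum_sub_distrib]
      refine Finset.sum_congr rfl fun r _ => ?_
      have := hindV q
      calc ind A0 q * ind Bp r * (if TotDist q r = true then (1:ℤ) else 0) * (1 - ind V (thirdPt q r))
          = (ind A0 q * ind V q) * ind Bp r * tV q r - ind A0 q * ind Bp r * tV q r * ind V (thirdPt q r) := by rw [this]; simp only [htV]; ring
        _ = ind A0 q * ind Bp r * tV q r * ind V q - ind A0 q * ind Bp r * tV q r * ind V (thirdPt q r) := by ring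
    rw [e1] at h
    exact h
  -- the frozen corner: yBp = 2^k nBp + Γ
  have hfro' : yBp = 2 ^ k * nBp + Γ := by
    -- yBp and the λ-sum as indicator sums over A0 ∩ Bp
    have e1 : (∑ q ∈ A0 ∩ Bp, dV q) = yBp := by
      rw [hyBp, sum_mem_eq_sum_ind_mul (A0 ∩ Bp)]
      refine Finset.sum_congr rfl fun q _ => ?_
      rw [ind_inter_eq_mul]
    have e2 : (∑ q ∈ A0 ∩ Bp, lamU V q) = ∑ q : Pd k, ind A0 q * ind Bp q * lamU V q := by
      rw [sum_mem_eq_sum_ind_mul (A0 ∩ Bp)]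
      refine Finset.sum_congr rfl fun q _ => ?_
      rw [ind_inter_eq_mul]
    -- λ_V(q) = 2^k·1_V(q) + Σ_s t(q,s)(1 − 1_V(s)) + (2^k·1_V(q) − 2^k) ; on A0 ⊆ V this is 2^k + Σ_s t(q,s)(1 − 1_V(s))
    have e3 : ∀ q : Pd k, ind A0 q * ind Bp q * lamU V q = 2 ^ k * (ind A0 q * ind Bp q * ind V q) + ∑ s : Pd k, ind A0 q * ind Bp q * tV q s * (1 - ind V s) := by
      intro q
      unfold lamU
      rw [nuCount_eq_sum_ind]
      have htot : (∑ s : Pd k, tV q s) = 2 ^ k := by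
        simp only [htV]
        have := sum_ite_totDist_eq_pow q
        rw [← this]
        refine Finset.sum_congr rfl fun s _ => ?_
        rw [totDist_symm]
      have hnu : (∑ p : Pd k, ind V p * (if TotDist p q = true then (1:ℤ) else 0)) = ∑ s : Pd k, tV q s * ind V s := by
        refine Finset.sum_congr rfl fun s _ => ?_
        simp only [htV]; rw [totDist_symm]; ring
      rw [hnu]
      have hsplit : (∑ s : Pd k, ind A0 q * ind Bp q * tV q s * (1 - ind V s)) = ind A0 q * ind Bp q * ((∑ s : Pd k, tV q s) - ∑ s : Pd k, tV q s * ind V s) := by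
        rw [← Finset.sum_sub_distrib, Finset.mul_sum]
        refine Finset.sum_congr rfl fun s _ => ?_; ring
      rw [hsplit, htot]
      have := hindV q
      have e4 : ind A0 q * ind Bp q * ind V q = ind A0 q * ind Bp q := by
        calc ind A0 q * ind Bp q * ind V q = (ind A0 q * ind V q) * ind Bp q := by ring
          _ = ind A0 q * ind Bp q := by rw [this]
      linear_combination ((2:ℤ) ^ k) * e4
    rw [← e1, hfro, e2, Finset.sum_congr rfl fun q _ => e3 q, Finset.sum_add_distrib, ← Finset.mul_sum, hnBp, hΓ]
  -- conclude via the crossed reduction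
  refine diagCert_coProduct_N_orTwo_crossed hS hFx hGy hA dS hdS dV hsub (hNV A0 B0 hA0u hB0u) ?_ hP hQ
  have hnBp0 : 0 ≤ nBp := by
    rw [hnBp]
    exact Finset.sum_nonneg fun q _ => mul_nonneg (mul_nonneg (ind_nonneg' A0 q) (ind_nonneg' Bp q)) (ind_nonneg' V q)
  linarith [hmix, hfro', hH1, hH2, hH3, hK]

/-- **COROLLARY (the pattern functional at these crossed pairs; every `k`).**  With (T) for `dS` and the box `dS ≤ 8·1_S` in addition:
`0 ≤ sStarD ((x∨y) × (↑a ∪ ↑b)) P Q`. [this work] -/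
theorem sStarD_blockAnd_orTwo_crossed_aligned_general_nonneg (hS : ∀ ξ η : Pd 1, glue ξ η ∈ S ↔ (1 ≤ ξ 0 ∨ 1 ≤ η 0))
    (hFx : ∀ ξ η : Pd 1, glue ξ η ∈ Fx ↔ 1 ≤ ξ 0) (hGy : ∀ ξ η : Pd 1, glue ξ η ∈ Gy ↔ 1 ≤ η 0)
    (hA : ∀ σ z, glue σ z ∈ A ↔ (σ ∈ S ∧ z ∈ V))
    (dS : Pd (1 + 1) → ℤ) (hdS : dS (glue (fun _ => 0) (fun _ => 0)) = 0 ∧ dS (glue (fun _ => 0) (fun _ => 1)) = 4 ∧ dS (glue (fun _ => 0) (fun _ => 2)) = 4 ∧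
      dS (glue (fun _ => 1) (fun _ => 0)) = 2 ∧ dS (glue (fun _ => 1) (fun _ => 1)) = 5 ∧ dS (glue (fun _ => 1) (fun _ => 2)) = 5 ∧
      dS (glue (fun _ => 2) (fun _ => 0)) = 2 ∧ dS (glue (fun _ => 2) (fun _ => 1)) = 5 ∧ dS (glue (fun _ => 2) (fun _ => 2)) = 5)
    (hTS : ∀ W' : Finset (Pd (1 + 1)), IsUpperSet (W' : Set (Pd (1 + 1))) → (∑ ξ ∈ W', dS ξ) ≤ ∑ ξ ∈ W', lamU S ξ)
    (hmS : ∀ ξ : Pd (1 + 1), dS ξ ≤ 2 * (2:ℤ) ^ (1 + 1) * ind S ξ)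
    {a b a' : Pd k} {Sx : Finset (Fin k)} (hVm : ∀ q, q ∈ V ↔ (a ≤ q ∨ b ≤ q))
    (haS : ∀ i, i ∉ Sx → a i = 0) (hbS : ∀ i, i ∈ Sx → b i = 0) (haa : a ≤ a')
    {A0 Bp B0 : Finset (Pd k)} (hA0 : ∀ q, q ∈ A0 ↔ a' ≤ q) (hB0 : ∀ q, q ∈ B0 ↔ b ≤ q)
    (hBpu : IsUpperSet (Bp : Set (Pd k))) (hsub : Bp ⊆ B0)
    (dV : Pd k → ℤ)
    (hTV : ∀ W' : Finset (Pd k), IsUpperSet (W' : Set (Pd k)) → (∑ q ∈ W', dV q) ≤ ∑ q ∈ W', lamU V q)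
    (hNV : ∀ X X' : Finset (Pd k), IsUpperSet (X : Set (Pd k)) → IsUpperSet (X' : Set (Pd k)) → (∑ q ∈ X, ∑ r ∈ X', thetaVal V q r) ≤ ∑ q ∈ X ∩ X', dV q)
    {P Q : Finset (Pd ((1 + 1) + k))} (hPu : IsUpperSet (P : Set (Pd ((1 + 1) + k)))) (hQu : IsUpperSet (Q : Set (Pd ((1 + 1) + k))))
    (hP : ∀ σ q, glue σ q ∈ P ↔ (σ ∈ Fx ∧ q ∈ A0)) (hQ : ∀ σ q, glue σ q ∈ Q ↔ (q ∈ Bp ∨ (σ ∈ Gy ∧ q ∈ B0))) :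
    0 ≤ sStarD A P Q := by
  rw [sStarD_eq_sum_lamU_sub_sum_thetaVal]
  have hT := diagCert_coProduct_T hA dS dV hTS hTV hmS (isUpperSet_inter_coe hPu hQu)
  have hN := diagCert_coProduct_N_orTwo_crossed_aligned_general hS hFx hGy hA dS hdS hVm haS hbS haa hA0 hB0 hBpu hsub dV hTV hNV hP hQ
  linarith

end AlignedGeneral

end Summit.CriticalPhenomena.PercolationContinuityZ3.Theorems.SahiGridPattern
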